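import Literature.Computability.Cryptography.HallgrenPellQuantum
import HarnessLib

/-!
# Hallgren's regulator algorithm over an abstract infrastructure, I: Fourier sampling of the walk table

Topic `Computability/Cryptography`; the generic content of `HallgrenPellQuantum.lean` (Jozsa 2003, §10,
Thm. 6: the quantum core of Hallgren's algorithm and its analysis), made ABSTRACT IN THE INSTANCE. There the
analysis is written for the principal cycle of a real quadratic discriminant (`HallgrenQuantum.Gx`); every
step only uses that the cycle is a `GiantStepCycle` with adequate walk parameters and a handful of numeric
facts (`S = N R ≥ 5000`, `3 S² ≤ Q`, few ideals per period), so here those facts are HYPOTHESES and the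
cycle is any `G : GiantStepCycle ι` — the form consumed by the regulator computation of other infrastructures
(complex cubic fields: Buchmann–Williams 1988) through the same shift experiment `hallgrenSS`.
Theorem-only file, no named facts, no definitions.

* `le_dbl_gen`, `hV_range_gen`, **`exists_blurred_gen`** — for a frozen start-up, adequate final rounds and
  precision `N (E_tot + 2η) ≤ 2`, the computed table `G.table N s₀ T (2M)` on `[0, Q)` (`N = Ngrid n`,
  `Q = 2^{LQ n}`, `T = Tdbl n`) is a blurred gap table with pitch `S = N R`, `G.n` ideals per period,
  `1 ≤ w ≤ 3`, `0 ≤ e ≤ 2` (`GiantStepCycle.blurred`);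
* `Kh_bounds_gen`, `ck_spec_gen`, `ck_injOn_gen` — the small harmonics `⌊kQ/S⌉`, `1 ≤ k ≤ ⌊S/210⌋`;
* `card_goodStarts_ge_quarter_gen` (`≥ S/4` good starts when `51 n + 7 ≤ 3S/4`), `teeth_ge_gen`,
  **`corrMass_ck_ge_gen`** — every small harmonic of any injective re-coding of a blurred gap table carries
  autocorrelation mass `≥ Q²/(2304 S)` (`BlurredGapTable.corrMass_harmonic_ge`, Jozsa's Lemma 3);
* `unitWeight_ge_gen`, `prob_unit_ge_gen`, `prob_pair_ge_gen`, **`prob_exists_goodPair_gen`** — the read-out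
  law of `hallgrenSS` on such a table: some of the `2^43` disjoint pairs of units reads a coprime pair of small
  harmonics with probability `≥ 4/5` (Kitaev's per-unit law `prob_cEst_ge`, `prob_twoSamples_ge`,
  `prob_exists_pair_ge`).

## References

* R. Jozsa, *Notes on Hallgren's efficient quantum algorithm for solving Pell's equation*,
  arXiv:quant-ph/0302134 (2003), §9 Thm. 5, §10 Prop. 36, Thm. 6, Lemma 3. [Jozsa2003]
* S. Hallgren, J. ACM 54 (2007), Art. 4. [Hallgren2007]
* A. Yu. Kitaev, arXiv:quant-ph/9511026 (1995), §3. [Kitaev1995]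
-/

noncomputable section

namespace Literature.Computability.Cryptography

namespace HallgrenQuantum

open PeriodFinding Finset WalkData

/-! ### The walk table is a blurred gap table -/

section Walk

variable {ι : Type*} (G : GiantStepCycle ι) (n s₀ : ℕ)

/-- `Q/N = 2^{L−a}` (as `Q_div_N`, for a length rather than a string). [folklore] -/
theorem Q_div_N_gen (n : ℕ) : (2 : ℝ) ^ LQ n / Ngrid n = 2 ^ (LQ n - aN n) := by
  rw [Ngrid_real, div_eq_iff (by positivity), ← pow_add, Nat.sub_add_cancel]
  unfold LQ aN; omega

/-- **The doubling depth is adequate**: every `y ≤ 2^{L−a}` is within `d̂(I_T)`, `T = L − a + 1`, once the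
start-up froze. [cite: Jozsa2003, §9 (proof of Thm. 5)] -/
theorem le_dbl_gen (hstart : 2 * G.K + 1 ≤ (G.start s₀).2) {y : ℝ} (hy : y ≤ (2 : ℝ) ^ (LQ n - aN n)) :
    y ≤ (G.dbl s₀ (Tdbl n)).2 := by
  refine G.le_dbl_of_le_two_pow hstart ?_
  have hT : Tdbl n = (LQ n - aN n) + 1 := rfl
  rw [hT, pow_succ]
  have : (0 : ℝ) ≤ 2 ^ (LQ n - aN n) := by positivity
  nlinarith

/-- The window `V = Q − 1` is within the walk's range. [folklore] -/
theorem hV_range_gen (hstart : 2 * G.K + 1 ≤ (G.start s₀).2) :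
    ((((2 ^ LQ n - 1 : ℕ) : ℤ) : ℝ) / Ngrid n) ≤ (G.dbl s₀ (Tdbl n)).2 := by
  refine le_dbl_gen G n s₀ hstart ?_
  rw [← Q_div_N_gen n]
  apply div_le_div_of_nonneg_right _ (by positivity)
  have : ((2 ^ LQ n - 1 : ℕ) : ℝ) ≤ ((2 ^ LQ n : ℕ) : ℝ) := by exact_mod_cast Nat.sub_le _ _
  push_cast at this ⊢; linarith

/-- **The walk table is a blurred gap table on `[0, Q)`** with pitch `S = N R`, `G.n` ideals per period,
anchor tolerance `1 ≤ w ≤ 3`, blur radius `0 ≤ e ≤ 2` (from `N (E_tot + 2η) ≤ 2`), agreeing with the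
computed table `G.table N s₀ T (2M)` on `[0, Q)`. [cite: Jozsa2003, §10 Prop. 36] -/
theorem exists_blurred_gen (M : ℕ) (hstart : 2 * G.K + 1 ≤ (G.start s₀).2)
    (hRes : G.Res s₀ (Tdbl n) < M * (G.L - 2 * G.η))
    (hEtot : (Ngrid n : ℝ) * (G.Etot s₀ (Tdbl n) (2 * M) + 2 * G.η) ≤ 2) :
    ∃ Tb : BlurredGapTable ι, Tb.S = Ngrid n * G.R ∧ Tb.n = G.n ∧ 1 ≤ Tb.w ∧ Tb.w ≤ 3 ∧ 0 ≤ Tb.e ∧ Tb.e ≤ 2 ∧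
      ∀ v : ℕ, v < 2 ^ LQ n → Tb.FN v = G.table (Ngrid n) s₀ (Tdbl n) (2 * M) (v : ℤ) := by
  have hE0 : 0 ≤ G.Etot s₀ (Tdbl n) (2 * M) := by
    unfold GiantStepCycle.Etot; have := G.Edesc_nonneg s₀ (Tdbl n) 0; have := G.η_nonneg; positivity
  have hN : (0 : ℝ) ≤ Ngrid n := by positivity
  have hNE : 0 ≤ (Ngrid n : ℝ) * G.Etot s₀ (Tdbl n) (2 * M) := mul_nonneg hN hE0
  have hNE2 : (Ngrid n : ℝ) * G.Etot s₀ (Tdbl n) (2 * M) ≤ 2 := by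
    have := G.η_nonneg; nlinarith
  refine ⟨G.blurred (Ngrid_pos n) (hV_range_gen G n s₀ hstart) hRes, rfl, rfl, ?_, ?_, hNE, hNE2, fun v hv => ?_⟩
  · show 1 ≤ (Ngrid n : ℝ) * G.Etot s₀ (Tdbl n) (2 * M) + 1
    linarith
  · show (Ngrid n : ℝ) * G.Etot s₀ (Tdbl n) (2 * M) + 1 ≤ 3
    linarith
  · have hv0 : (0 : ℤ) ≤ (v : ℤ) := Int.natCast_nonneg v
    have hvV : (v : ℤ) ≤ (((2 ^ LQ n - 1 : ℕ)) : ℤ) := by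
      have : v ≤ 2 ^ LQ n - 1 := by omega
      exact_mod_cast this
    exact G.blurred_F_of_mem (Ngrid_pos _) (hV_range_gen G n s₀ hstart) hRes hv0 hvV

end Walk

/-! ### Small harmonics: the number tried and the harmonic characters -/

section Harmonics

/-- `S/220 ≤ Kh ≤ S/210` for `Kh = ⌊S/210⌋`, `S ≥ 5000`. [folklore] -/
theorem Kh_bounds_gen {S : ℝ} (hS : 5000 ≤ S) :
    S / 220 ≤ ((⌊S / 210⌋₊ : ℕ) : ℝ) ∧ ((⌊S / 210⌋₊ : ℕ) : ℝ) ≤ S / 210 := by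
  have hS0 : 0 ≤ S / 210 := by positivity
  constructor
  · have := Nat.lt_floor_add_one (S / 210)
    linarith
  · exact Nat.floor_le hS0

/-- The harmonic character `⌊kQ/S⌉` is the rounding, a natural number `< Q`, within `1/2` of `kQ/S`
(`1 ≤ k ≤ Kh ≤ S/210`). [cite: Jozsa2003, §10 (proof of Thm. 6: j = ⌊kq/S⌉)] -/
theorem ck_spec_gen (n : ℕ) {S : ℝ} (hS : 5000 ≤ S) {Kh : ℕ} (hKh : (Kh : ℝ) ≤ S / 210) {k : ℕ} (hk : k ∈ Icc 1 Kh) :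
    (((round ((k : ℝ) * (2 : ℝ) ^ LQ n / S)).toNat : ℕ) : ℝ) = round ((k : ℝ) * (2 : ℝ) ^ LQ n / S) ∧
      (round ((k : ℝ) * (2 : ℝ) ^ LQ n / S)).toNat < 2 ^ LQ n ∧
      |(((round ((k : ℝ) * (2 : ℝ) ^ LQ n / S)).toNat : ℕ) : ℝ) - k * (2 : ℝ) ^ LQ n / S| ≤ 1 / 2 := by
  rw [mem_Icc] at hk
  set Q : ℝ := (2 : ℝ) ^ LQ n with hQ
  have hQ0 : 0 < Q := by positivity
  set t : ℝ := (k : ℝ) * Q / S with ht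
  have hS0 : (0 : ℝ) < S := by linarith
  have ht0 : 0 ≤ t := by positivity
  have htQ : t ≤ Q / 210 := by
    have hk' : (k : ℝ) ≤ Kh := by exact_mod_cast hk.2
    have hkS : (k : ℝ) ≤ S / 210 := hk'.trans hKh
    calc t = (k : ℝ) * Q / S := ht
      _ ≤ (S / 210) * Q / S := by
          apply div_le_div_of_nonneg_right _ hS0.le
          exact mul_le_mul_of_nonneg_right hkS hQ0.le
      _ = Q / 210 := by field_simp
  have hr := abs_sub_round t
  have hr0 : 0 ≤ round t := by
    have : (-1 : ℝ) < round t := by rw [abs_le] at hr; linarith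
    exact_mod_cast (show (-1 : ℤ) < round t by exact_mod_cast this)
  have hcast : (((round t).toNat : ℕ) : ℝ) = round t := by
    have : (((round t).toNat : ℕ) : ℤ) = round t := Int.toNat_of_nonneg hr0
    exact_mod_cast this
  refine ⟨hcast, ?_, by rw [hcast]; rw [abs_sub_comm] at hr; exact hr⟩
  have hQ1 : (1 : ℝ) ≤ Q := by rw [hQ]; exact one_le_pow₀ (by norm_num)
  have hlt : (round t : ℝ) < Q := by rw [abs_le] at hr; linarith
  rw [← hcast, hQ] at hlt
  exact_mod_cast hlt

/-- The harmonic characters are injective on `[1, Kh]` (two of them are `≥ Q/S − 1 > 0` apart). [folklore] -/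
theorem ck_injOn_gen (n : ℕ) {S : ℝ} (hS : 5000 ≤ S) (hQ3 : 3 * S ^ 2 ≤ (2 : ℝ) ^ LQ n) {Kh : ℕ} {ck : ℕ → ℕ}
    (hck : ∀ k ∈ Icc 1 Kh, ck k < 2 ^ LQ n ∧ |((ck k : ℕ) : ℝ) - k * (2 : ℝ) ^ LQ n / S| ≤ 1 / 2) :
    Set.InjOn ck (Icc 1 Kh : Finset ℕ) := by
  intro k hk k' hk' h
  have h1 := (hck k hk).2
  have h2 := (hck k' hk').2
  have hS0 : (0 : ℝ) < S := by linarith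
  have hQS : 2 < (2 : ℝ) ^ LQ n / S := by rw [lt_div_iff₀ hS0]; nlinarith
  by_contra hne
  have hkk : (1 : ℝ) ≤ |(k : ℝ) - k'| := by
    rcases lt_or_gt_of_ne hne with hlt | hlt
    · have : (k : ℝ) + 1 ≤ k' := by exact_mod_cast hlt
      rw [abs_sub_comm, abs_of_pos (by linarith)]; linarith
    · have : (k' : ℝ) + 1 ≤ k := by exact_mod_cast hlt
      rw [abs_of_pos (by linarith)]; linarith
  have heq : ((ck k : ℕ) : ℝ) = ck k' := by exact_mod_cast h
  have hdiff : |(k : ℝ) * (2 : ℝ) ^ LQ n / S - k' * (2 : ℝ) ^ LQ n / S| ≤ 1 := by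
    have := abs_sub_le ((k : ℝ) * (2 : ℝ) ^ LQ n / S) (ck k : ℝ) (k' * (2 : ℝ) ^ LQ n / S)
    rw [abs_sub_comm] at h1; rw [heq] at h1 this; linarith
  have e : (k : ℝ) * (2 : ℝ) ^ LQ n / S - k' * (2 : ℝ) ^ LQ n / S = ((k : ℝ) - k') * ((2 : ℝ) ^ LQ n / S) := by ring
  have hQS0 : (0 : ℝ) < (2 : ℝ) ^ LQ n / S := by linarith
  rw [e, abs_mul, abs_of_pos hQS0] at hdiff
  nlinarith

end Harmonics

/-! ### The mass at the harmonics -/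

section Mass

variable {ι : Type*} (Tb : BlurredGapTable ι)

/-- **At least `S/4` good starts** when `1 ≤ w ≤ 3`, `0 ≤ e ≤ 2` and `51 n + 7 ≤ 3S/4`
(`#good ≥ B − n((B + 2μ)/S + 1)(2μ + 1)`, `μ = 2w + e ≤ 8`, `B ≥ S − 7`). [cite: Jozsa2003, §10 Prop. 36 (iii)] -/
theorem card_goodStarts_ge_quarter_gen (hS : 5000 ≤ Tb.S) (hw1 : 1 ≤ Tb.w) (hw3 : Tb.w ≤ 3) (he0 : 0 ≤ Tb.e)
    (he2 : Tb.e ≤ 2) (hn : 51 * (Tb.n : ℝ) + 7 ≤ 3 * Tb.S / 4) : Tb.S / 4 ≤ (Tb.goodStarts.card : ℝ) := by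
  have hgood := Tb.card_goodStarts_ge
  have hB1 : Tb.S - 2 * Tb.w - 1 ≤ (Tb.B : ℝ) := by
    have := Nat.lt_floor_add_one (Tb.S - 2 * Tb.w)
    unfold BlurredGapTable.B; linarith
  have hB2 : (Tb.B : ℝ) ≤ Tb.S := by
    have h0 : 0 ≤ Tb.S - 2 * Tb.w := by linarith
    have := Nat.floor_le h0
    unfold BlurredGapTable.B; linarith
  have hS0 : 0 < Tb.S := by linarith
  have hfrac : ((Tb.B : ℝ) + 2 * (2 * Tb.w + Tb.e)) / Tb.S + 1 ≤ 3 := by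
    rw [div_add_one hS0.ne', div_le_iff₀ hS0]; nlinarith
  have hB0 : (0 : ℝ) ≤ (Tb.B : ℝ) := Nat.cast_nonneg _
  have hf0 : (0 : ℝ) ≤ ((Tb.B : ℝ) + 2 * (2 * Tb.w + Tb.e)) / Tb.S + 1 :=
    add_nonneg (div_nonneg (by linarith) hS0.le) zero_le_one
  have hμ : 2 * (2 * Tb.w + Tb.e) + 1 ≤ 17 := by linarith
  have hμ0 : (0 : ℝ) ≤ 2 * (2 * Tb.w + Tb.e) + 1 := by linarith
  have hn0 : (0 : ℝ) ≤ Tb.n := Nat.cast_nonneg _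
  have hprod : (Tb.n : ℝ) * (((Tb.B : ℝ) + 2 * (2 * Tb.w + Tb.e)) / Tb.S + 1) * (2 * (2 * Tb.w + Tb.e) + 1) ≤
      (Tb.n : ℝ) * 3 * 17 := by
    have := mul_le_mul (mul_le_mul_of_nonneg_left hfrac hn0) hμ hμ0 (by positivity)
    linarith
  linarith

/-- **At least `Q/(2S)` teeth** (`Q ≥ 3S²`, `S ≥ 5000`). [folklore] -/
theorem teeth_ge_gen (n : ℕ) {S : ℝ} (hS : 5000 ≤ S) (hQ3 : 3 * S ^ 2 ≤ (2 : ℝ) ^ LQ n) :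
    (2 : ℝ) ^ LQ n / (2 * S) ≤ (((⌊((2 ^ LQ n : ℕ) : ℝ) / S⌋₊ - 1 : ℕ)) : ℝ) := by
  have hQnat : ((2 ^ LQ n : ℕ) : ℝ) = (2 : ℝ) ^ LQ n := by push_cast; ring
  rw [hQnat]
  generalize hQv : (2 : ℝ) ^ LQ n = Q at hQ3
  have hS0 : 0 < S := by linarith
  have hQS : 4 ≤ Q / S := by rw [le_div_iff₀ hS0]; nlinarith
  have hfl := Nat.lt_floor_add_one (Q / S)
  have hfl1 : 1 ≤ ⌊Q / S⌋₊ := (Nat.one_le_floor_iff _).2 (by linarith)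
  rw [Nat.cast_sub hfl1, Nat.cast_one, div_le_iff₀ (by linarith)]
  have e : Q / S * (2 * S) = 2 * Q := by field_simp
  nlinarith

/-- **Every small harmonic is a heavy character** of any injective re-coding `F` of a blurred gap table on
`[0, Q)`: `corrMass Q F c ≥ Q²/(2304 S)` for `c` within `1/2` of `kQ/S`, `1 ≤ k ≤ Kh ≤ S/210` (Jozsa's Thm. 6
with Lemma 3 through `BlurredGapTable.corrMass_harmonic_ge`, `≥ S/4` good starts, `≥ Q/(2S)` teeth).
[cite: Jozsa2003, §10 Thm. 6 (proof: prob(j) ≥ c/S) with Lemma 3] -/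
theorem corrMass_ck_ge_gen (n : ℕ) {Ω : Type*} [DecidableEq Ω] (F : ℕ → Ω)
    (hF : ∀ v < 2 ^ LQ n, ∀ v' < 2 ^ LQ n, (F v = F v' ↔ Tb.FN v = Tb.FN v'))
    (hS : 5000 ≤ Tb.S) (hQ3 : 3 * Tb.S ^ 2 ≤ (2 : ℝ) ^ LQ n) (hw1 : 1 ≤ Tb.w) (hw3 : Tb.w ≤ 3) (he0 : 0 ≤ Tb.e)
    (he2 : Tb.e ≤ 2) (hn : 51 * (Tb.n : ℝ) + 7 ≤ 3 * Tb.S / 4) {Kh : ℕ} (hKh : (Kh : ℝ) ≤ Tb.S / 210)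
    {k : ℕ} (hk : k ∈ Icc 1 Kh) {c : ℕ} (hc : |(c : ℝ) - k * (2 : ℝ) ^ LQ n / Tb.S| ≤ 1 / 2) :
    ((2 : ℝ) ^ LQ n) ^ 2 / (2304 * Tb.S) ≤ corrMass (2 ^ LQ n) F c := by
  rw [mem_Icc] at hk
  have hQnat : ((2 ^ LQ n : ℕ) : ℝ) = (2 : ℝ) ^ LQ n := by push_cast; ring
  have hk' : (k : ℝ) ≤ Kh := by exact_mod_cast hk.2
  have hk0 : (0 : ℝ) ≤ k := Nat.cast_nonneg _
  -- the side conditions of Jozsa's estimate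
  have hSS : (25000000 : ℝ) ≤ Tb.S ^ 2 := by nlinarith only [hS]
  have hQbig : (75000000 : ℝ) ≤ (2 : ℝ) ^ LQ n := by linarith only [hQ3, hSS]
  have c1 : 1 ≤ Tb.S := by linarith only [hS]
  have c2 : 100 * (2 * Tb.w + 1) ≤ ((2 ^ LQ n : ℕ) : ℝ) := by rw [hQnat]; linarith only [hQbig, hw3]
  have c3 : 5 * Tb.S + 5 * (2 * Tb.w + 1) ≤ ((2 ^ LQ n : ℕ) : ℝ) := by rw [hQnat]; nlinarith only [hS, hQ3, hw3]
  have c4 : 30 * (k : ℝ) * (2 * Tb.w + 1) ≤ Tb.S := by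
    have : 30 * (k : ℝ) * (2 * Tb.w + 1) ≤ 30 * (k : ℝ) * 7 := by nlinarith only [hk0, hw3]
    nlinarith only [this, hk', hKh]
  have c5 : |(((c : ℕ) : ℤ) : ℝ) - k * ((2 ^ LQ n : ℕ) : ℝ) / Tb.S| ≤ 1 / 2 := by
    rw [hQnat]; push_cast; exact hc
  have hmain := Tb.corrMass_harmonic_ge c1 c2 c3 c4 c5
  have hcard := card_goodStarts_ge_quarter_gen Tb hS hw1 hw3 he0 he2 hn
  have hteeth := teeth_ge_gen n hS hQ3
  have harith := mass_arith hS hcard hteeth (pow_nonneg (by norm_num) _)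
  -- `corrMass_harmonic_ge` carries the classical `DecidableEq` instance; transfer along the level-set relation
  have key : ∀ {i : DecidableEq (ι × ℤ)} (c' : ℤ), corrMass (2 ^ LQ n) F c' = @corrMass _ i (2 ^ LQ n) Tb.FN c' :=
    fun {i} c' => @corrMass_congr_rel _ _ _ i _ _ _ hF c'
  exact le_trans harith (le_trans hmain (le_of_eq (key _).symm))

end Mass

/-! ### The read-out law of the shift experiment on the table -/

section Units

variable (w : List Bool) (F : ℕ → List Bool)

/-- **The weight of a character of mass `≥ Q²/(2304 S)` in a unit is `≥ 1/(2304 S)`.** [cite: Jozsa2003, §10 Thm. 6 (proof)] -/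
theorem unitWeight_ge_gen {S : ℝ} (u : Ux (x := w)) {c : ℕ}
    (hmass : ((2 : ℝ) ^ LQ w.length) ^ 2 / (2304 * S) ≤ corrMass (2 ^ LQ w.length) F c) :
    1 / (2304 * S) ≤ unitWeight (Lux (x := w)) (fun _ => F) u c := by
  unfold unitWeight
  rw [Qof_Lux]
  have hq : (((2 ^ LQ w.length : ℕ)) : ℝ) = (2 : ℝ) ^ LQ w.length := by push_cast; ring
  rw [hq, le_div_iff₀ (pow_pos (pow_pos (by norm_num) _) 2)]
  have e : 1 / (2304 * S) * ((2 : ℝ) ^ LQ w.length) ^ 2 = ((2 : ℝ) ^ LQ w.length) ^ 2 / (2304 * S) := by ring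
  rw [e]
  exact hmass

/-- **Each unit reads a character `c < Q` of mass `≥ Q²/(2304 S)` with probability `≥ 1/(4608 S)`**
(Kitaev's per-unit law with accuracy defect `1/2`). [cite: Kitaev1995, §3 Thm 1] -/
theorem prob_unit_ge_gen {S : ℝ} (u : Ux (x := w)) {c : ℕ} (hcQ : c < 2 ^ LQ w.length)
    (hmass : ((2 : ℝ) ^ LQ w.length) ^ 2 / (2304 * S) ≤ corrMass (2 ^ LQ w.length) F c) :
    1 / (4608 * S) ≤
      prob (X := fun _ : Ux (x := w) => TIdx (LvQ w.length) (Brep w.length) → Bool)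
        (unitLaw (Lux (x := w)) (fun _ => F))
        (univ.filter fun γ => cEst (Qof (Lux (x := w)) u) (γ u) = c) := by
  have hcQ' : c < Qof (Lux (x := w)) u := by rw [Qof_Lux]; exact hcQ
  have hB : 0 < Brep w.length := by unfold Brep; omega
  have hLv : 0 < LvQ w.length := by unfold LvQ; omega
  have hQLv : Qof (Lux (x := w)) u ≤ 2 ^ (LvQ w.length - 1) := by
    rw [Qof_Lux]; unfold LvQ; simp
  have h := prob_cEst_ge (Lux (x := w)) (fun _ => F) hB hLv hQLv ⟨c, hcQ'⟩
  have hw := unitWeight_ge_gen w F u hmass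
  have hacc : ηacc (LvQ w.length) (Brep w.length) = 1 / 2 := etaacc_eq w.length
  rw [hacc] at h
  have e : (1 : ℝ) / (4608 * S) = (1 - 1 / 2) * (1 / (2304 * S)) := by ring
  rw [e]
  exact le_trans (mul_le_mul_of_nonneg_left hw (by norm_num)) h

variable {S : ℝ} {Kh : ℕ} {ck : ℕ → ℕ}

/-- **A pair of units reads a coprime pair of small harmonics with probability `≥ 2^{−41}`**
(`Kh ≥ S/220` harmonics, each read with probability `≥ 1/(4608 S)`, `prob_twoSamples_ge`).
[cite: Jozsa2003, §10 (proof of Thm. 6: two runs, gcd = 1)] -/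
theorem prob_pair_ge_gen (hS : 5000 ≤ S) (hKh : S / 220 ≤ (Kh : ℝ)) (hinj : Set.InjOn ck (Icc 1 Kh : Finset ℕ))
    (hck : ∀ k ∈ Icc 1 Kh, ck k < 2 ^ LQ w.length)
    (hmass : ∀ k ∈ Icc 1 Kh, ((2 : ℝ) ^ LQ w.length) ^ 2 / (2304 * S) ≤ corrMass (2 ^ LQ w.length) F (ck k))
    (i : Fin NPAIRS) :
    (1 : ℝ) / 2 ^ 41 ≤ prob (X := fun _ : Ux (x := w) => TIdx (LvQ w.length) (Brep w.length) → Bool)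
      (unitLaw (Lux (x := w)) (fun _ => F))
      (univ.filter fun γ => ∃ kk ∈ ((Icc 1 Kh) ×ˢ (Icc 1 Kh)).filter (fun kl : ℕ × ℕ => Nat.Coprime kl.1 kl.2),
        cEst (Qof (Lux (x := w)) (ua i)) (γ (ua i)) = ck kk.1 ∧ cEst (Qof (Lux (x := w)) (ub i)) (γ (ub i)) = ck kk.2) := by
  have hq0 : (0 : ℝ) ≤ 1 / (4608 * S) := div_nonneg zero_le_one (by linarith)
  have h := prob_twoSamples_ge (Lv := LvQ w.length) (B := Brep w.length) (Lux (x := w)) (fun _ => F)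
    (u := ua i) (u' := ub i) ((disjointPairs (x := w)).a_ne_b i i) Kh ck ck hinj hinj hq0 hq0
    (fun k hk => prob_unit_ge_gen w F (ua i) (hck k hk) (hmass k hk))
    (fun k hk => prob_unit_ge_gen w F (ub i) (hck k hk) (hmass k hk))
  exact le_trans (pair_const_le hS hKh) h

/-- **Some pair of units reads a coprime pair of small harmonics with probability `≥ 4/5`**
(`2^43` disjoint pairs, each succeeding with probability `≥ 2^{−41}`, `prob_exists_pair_ge`, and Bernoulli's
`(1 − p)^m ≤ 1/(1 + m p)`). [cite: Jozsa2003, §10 (repetition boosts 1/poly to a constant)] -/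
theorem prob_exists_goodPair_gen (hS : 5000 ≤ S) (hKh : S / 220 ≤ (Kh : ℝ))
    (hinj : Set.InjOn ck (Icc 1 Kh : Finset ℕ)) (hck : ∀ k ∈ Icc 1 Kh, ck k < 2 ^ LQ w.length)
    (hmass : ∀ k ∈ Icc 1 Kh, ((2 : ℝ) ^ LQ w.length) ^ 2 / (2304 * S) ≤ corrMass (2 ^ LQ w.length) F (ck k)) :
    (4 : ℝ) / 5 ≤ prob (X := fun _ : Ux (x := w) => TIdx (LvQ w.length) (Brep w.length) → Bool)
      (unitLaw (Lux (x := w)) (fun _ => F))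
      (univ.filter fun γ => ∃ i : Fin NPAIRS,
        ∃ kk ∈ ((Icc 1 Kh) ×ˢ (Icc 1 Kh)).filter (fun kl : ℕ × ℕ => Nat.Coprime kl.1 kl.2),
          cEst (Qof (Lux (x := w)) (ua i)) (γ (ua i)) = ck kk.1 ∧ cEst (Qof (Lux (x := w)) (ub i)) (γ (ub i)) = ck kk.2) := by
  -- Bernoulli: `(1 − p)^m (1 + m p) ≤ ((1 + p)(1 − p))^m ≤ 1` (before the read-out law enters the context)
  have bern : ∀ {p : ℝ}, 0 ≤ p → p ≤ 1 → ∀ m : ℕ, (1 - p) ^ m ≤ 1 / (1 + m * p) := by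
    intro p hp0 hp1 m
    have hB := one_add_mul_le_pow (show (-2 : ℝ) ≤ p by linarith) m
    have h1 : (1 + (m : ℝ) * p) * (1 - p) ^ m ≤ ((1 + p) * (1 - p)) ^ m := by
      rw [mul_pow]; exact mul_le_mul_of_nonneg_right hB (pow_nonneg (by linarith) m)
    have h2 : ((1 + p) * (1 - p)) ^ m ≤ 1 := pow_le_one₀ (by nlinarith) (by nlinarith)
    have h3 : (0 : ℝ) < 1 + m * p := by have : (0 : ℝ) ≤ m * p := mul_nonneg (Nat.cast_nonneg m) hp0; linarith
    rw [le_div_iff₀ h3]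
    linarith [mul_comm ((1 - p) ^ m) (1 + (m : ℝ) * p)]
  have hb := bern (p := (1 : ℝ) / 2 ^ 41) (by norm_num) (by norm_num) NPAIRS
  rw [NPAIRS_real] at hb
  have h := prob_exists_pair_ge (unitLaw_isProbVec (Lux (x := w)) (fun _ => F)) (disjointPairs (x := w))
    (fun i γa γb => ∃ kk ∈ ((Icc 1 Kh) ×ˢ (Icc 1 Kh)).filter (fun kl : ℕ × ℕ => Nat.Coprime kl.1 kl.2),
      cEst (Qof (Lux (x := w)) (ua i)) γa = ck kk.1 ∧ cEst (Qof (Lux (x := w)) (ub i)) γb = ck kk.2)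
    univ (p := (1 : ℝ) / 2 ^ 41) (fun i _ => prob_pair_ge_gen w F hS hKh hinj hck hmass i)
  rw [card_univ, Fintype.card_fin] at h
  have h5 : (1 : ℝ) / (1 + (2 : ℝ) ^ 43 * (1 / 2 ^ 41)) = 1 / 5 := by norm_num
  rw [h5] at hb
  -- hide the huge power (irreducible exponent) from the arithmetic
  generalize ht : ((1 : ℝ) - 1 / 2 ^ 41) ^ NPAIRS = t at h hb
  have h45 : (4 : ℝ) / 5 ≤ 1 - t := by linarith
  refine le_trans h45 (le_trans h (le_of_eq (congrArg (prob (unitLaw (Lux (x := w)) (fun _ => F))) ?_)))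
  ext γ
  simp only [mem_filter, mem_univ, true_and]

end Units

end HallgrenQuantum

end Literature.Computability.Cryptography

end
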